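/-
Copyright (c) 2026. All rights reserved.
Released under Apache 2.0 license as described in the file LICENSE.
-/
import Summits.HubbardSuperconductivity.HubbardLadder.Bounds.SectorVarianceBound
import HarnessLib

/-!
# The centred fugacity window (bounds.tex §13, D5(a))

HONEST FRAMING: ladder R1–R4 with certified numbers; no claim on H/H₀. These are bounds for
MODEL CLASSES (the typed repulsive/attractive `t–t'` Hubbard torus with a flux twist), no
materials claim.

Theorem 13_N (#211.8/#211.18/#211.19) is applied at a CENTRED base fugacity `s*`, `gcMean w n s* =
N` (#211.7 `exists_gcMean_eq`), and every `s`-dependent constant of the bound (`z(βU,s)`,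
`offArcRate`, the walk constant) must be controlled at `s*`. This part LOCATES `s*`: the mean
particle number of the untwisted sector ensemble is the atomic density up to a Kotecký–Preiss
error,

`|gcMean w n s - |Λ_L| · n_at(βU, s)| ≤ 2a|Λ_L| / r`   (`abs_gcMean_sub_card_mul_atomicDensity_le`),

for EVERY real `s`, under exactly the arc / Kotecký–Preiss hypotheses of the variance bound #211.11
(`0 ≤ c₀ ≤ cos r₁`, `|βU| ≤ u₀`, floor constant `R`, `a, δ > 0` with the one-site smallness,
radii `0 < r < r₁ ≤ π/4`). MECHANISM (the first-derivative twin of #211.9/#211.11): on the disc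
`|ζ - s| < r₁` the generalised Gibbs factor factorises, `Zc(ζ/β) = z(βU,ζ)^{|Λ|} Ξ_poly(ζ) =
e^{g₁ + g₂}`, `g₁ = |Λ| log z`, `g₂ = log Ξ_poly` (#211.3, #211.10); `(g₁ + g₂)'(s) = gcMean`
(#211.9 `deriv_eq_gcPowSumC_div`), `g₁'(s) = |Λ| n_at(s)` and `|g₂'(s)| ≤ 2a|Λ|/r` by CAUCHY'S
ESTIMATE from `‖g₂‖ ≤ a|Λ|` on the disc (#211.10 `norm_polymerLogZ_ttActivityMu_le`).

CONSEQUENCES: at a centred `s*` (`gcMean = ν`), `|n_at(βU, s*) - ν/|Λ_L|| ≤ 2a/r`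
(`abs_atomicDensity_sub_le_of_gcMean_eq`); since `n_at(βU, ·)` is STRICTLY INCREASING
(`atomicDensity_strictMono`, elementary), any two test points `s₋, s₊` with
`n_at(s₋) + 2a/r ≤ ν/|Λ_L| ≤ n_at(s₊) - 2a/r` enclose it: `s₋ ≤ s* ≤ s₊`
(`ttCentredFugacity_mem_window`). The successor evaluates the explicit `n_at` at two points; no
other model input enters D5(a). No numerics, no `native_decide`; standard axioms only. References:
R. Kotecký, D. Preiss, Comm. Math. Phys. 103 (1986) 491 [KoteckyPreiss1986]; D. Ueltschi,
Analyticity in Hubbard models, J. Stat. Phys. 95 (1999) 693, §2.3 Prop. 2.2 [Ueltschi1999];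
bounds.tex §13 Lemma 13.4 / D5(a).
-/

noncomputable section

namespace Summit.HubbardSuperconductivity.HubbardLadder.Bounds

open Matrix Finset Complex Metric
open Literature.MathematicalPhysics.QuantumLattice
open Literature.Probability.LatticeModels
open scoped ComplexOrder

/-! ### The first logarithmic derivative is the mean: Cauchy-estimate form -/

/-- **THEOREM (mean = atomic part + Cauchy error; bounds.tex Lemma 13.4, first-derivative form).**
Let `w_0, …, w_n` be real weights, `s` real, `0 < R < R₁`, and `g₁, g₂` complex-differentiable
on `B(s, R₁)` with `e^{g₁ + g₂} = Σ_k e^{ζk} w_k` there. If `‖g₂(ζ) - g₂(s)‖ ≤ C` on the circle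
`|ζ - s| = R` then `|gcMean w n s - Re g₁'(s)| ≤ C / R`. [folklore: Cauchy's estimate; this file] -/
theorem abs_gcMean_sub_le_of_exp_add_eq (w : ℕ → ℝ) (n : ℕ) (s : ℝ)
    {R R₁ C : ℝ} (hR : 0 < R) (hRR₁ : R < R₁) {g₁ g₂ : ℂ → ℂ}
    (hg₁ : DifferentiableOn ℂ g₁ (ball (s : ℂ) R₁))
    (hg₂ : DifferentiableOn ℂ g₂ (ball (s : ℂ) R₁))
    (hexp : ∀ ζ ∈ ball (s : ℂ) R₁, cexp (g₁ ζ + g₂ ζ) = gcPowSumC 0 w n ζ)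
    (hC : ∀ ζ ∈ sphere (s : ℂ) R, ‖g₂ ζ - g₂ s‖ ≤ C) :
    |gcMean w n s - (deriv g₁ (s : ℂ)).re| ≤ C / R := by
  have hR₁ : 0 < R₁ := hR.trans hRR₁
  have hs : (s : ℂ) ∈ ball (s : ℂ) R₁ := mem_ball_self hR₁
  have hg : DifferentiableOn ℂ (fun ζ => g₁ ζ + g₂ ζ) (ball (s : ℂ) R₁) := hg₁.add hg₂
  -- `(g₁ + g₂)'(s) = F₁(s)/F₀(s) = gcMean`
  have hd : deriv (fun ζ => g₁ ζ + g₂ ζ) (s : ℂ) = ((gcMean w n s : ℝ) : ℂ) := by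
    rw [deriv_eq_gcPowSumC_div hg hexp hs, gcPowSumC_ofReal, gcPowSumC_ofReal, gcPowSum_zero,
      gcPowSum_one, ← Complex.ofReal_div]
    rfl
  have hsum : deriv (fun ζ => g₁ ζ + g₂ ζ) (s : ℂ) = deriv g₁ (s : ℂ) + deriv g₂ (s : ℂ) :=
    deriv_add (hg₁.differentiableAt (isOpen_ball.mem_nhds hs))
      (hg₂.differentiableAt (isOpen_ball.mem_nhds hs))
  -- Cauchy's estimate for `g₂ - g₂(s)` on the circle of radius `R`
  have hdc : DiffContOnCl ℂ (fun ζ => g₂ ζ - g₂ s) (ball (s : ℂ) R) := by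
    have hsub : closure (ball (s : ℂ) R) ⊆ ball (s : ℂ) R₁ :=
      closure_ball_subset_closedBall.trans (closedBall_subset_ball hRR₁)
    exact ((hg₂.sub_const (g₂ s)).mono hsub).diffContOnCl
  have hcau := Complex.norm_deriv_le_of_forall_mem_sphere_norm_le hR hdc hC
  rw [deriv_sub_const] at hcau
  -- assemble: `gcMean = Re g₁' + Re g₂'`
  have hre : gcMean w n s = (deriv g₁ (s : ℂ)).re + (deriv g₂ (s : ℂ)).re := by
    have h := congrArg Complex.re (hd.symm.trans hsum)
    rwa [Complex.ofReal_re, Complex.add_re] at h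
  rw [hre, add_sub_cancel_left]
  exact (Complex.abs_re_le_norm _).trans hcau

/-! ### The atomic density is strictly increasing in the fugacity -/

/-- **`s ↦ n_at(v, s)` is strictly increasing** (`n_at = (2e^{s} + 2e^{2s-v}) / z(v,s)`; the
difference of cross products is `2 (e^{t} - e^{s}) (1 + e^{-v}(e^{s} + e^{t}) + e^{-v} e^{s} e^{t})
> 0`). [elementary; this file] -/
theorem atomicDensity_strictMono (v : ℝ) : StrictMono (atomicDensity v) := by
  intro s t hst
  have hx : Real.exp s < Real.exp t := Real.exp_lt_exp.2 hst
  have e2 : ∀ u : ℝ, Real.exp (2 * u - v) = Real.exp u ^ 2 * Real.exp (-v) := fun u => by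
    rw [sq, ← Real.exp_add, ← Real.exp_add]; congr 1; ring
  unfold atomicDensity atomicZ
  rw [e2 s, e2 t, div_lt_div_iff₀ (by positivity) (by positivity), ← sub_pos]
  have key : (2 * Real.exp t + 2 * (Real.exp t ^ 2 * Real.exp (-v))) *
        (1 + 2 * Real.exp s + Real.exp s ^ 2 * Real.exp (-v)) -
      (2 * Real.exp s + 2 * (Real.exp s ^ 2 * Real.exp (-v))) *
        (1 + 2 * Real.exp t + Real.exp t ^ 2 * Real.exp (-v)) =
      2 * (Real.exp t - Real.exp s) *
        (1 + Real.exp (-v) * (Real.exp s + Real.exp t) +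
          Real.exp (-v) * Real.exp s * Real.exp t) := by
    ring
  rw [key]
  have hts : 0 < Real.exp t - Real.exp s := sub_pos.2 hx
  positivity

/-- **Enclosure by two test points**: if `|n_at(v,s) - ρ| ≤ η`, `n_at(v,s₋) + η ≤ ρ` and
`ρ ≤ n_at(v,s₊) - η` then `s₋ ≤ s ≤ s₊`. [this file] -/
theorem mem_window_of_abs_atomicDensity_sub_le {v s ρ η sm sp : ℝ}
    (h : |atomicDensity v s - ρ| ≤ η) (hm : atomicDensity v sm + η ≤ ρ)
    (hp : ρ ≤ atomicDensity v sp - η) : sm ≤ s ∧ s ≤ sp := by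
  obtain ⟨h1, h2⟩ := abs_le.1 h
  exact ⟨(atomicDensity_strictMono v).le_iff_le.1 (by linarith),
    (atomicDensity_strictMono v).le_iff_le.1 (by linarith)⟩

/-! ### The model: mean particle number versus the atomic density -/

section Torus

variable {L : ℕ} [NeZero L]

/-- **THEOREM (mean particle number = atomic density up to `2a|Λ|/r`; bounds.tex §13 D5(a)).** Let
`L ≥ 3`, `β ≠ 0`, real `t', U, s`; arc and floor parameters `0 ≤ c₀`, `|βU| ≤ u₀`, `R > 0` with
`R² (1 - (1-c₀)/2 - (1-c₀²)/(1+e^{-u₀/2})²) ≥ 1`; `a, δ > 0` with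
`16 S e^{2S} (R e^{a+δ} + a)² ≤ a` (`S = |β|(1+|t'|)`); radii `0 < r < r₁ ≤ π/4` with `c₀ ≤ cos r₁`
(EXACTLY the hypotheses of #211.11 `gcVar_ttSectorWeight_le`). Then
`|gcMean w n s - |Λ_L| · n_at(βU, s)| ≤ 2a|Λ_L|/r` (`w = ttSectorWeight L β t' U`,
`n = |Orb Λ_L|`). [programme: bounds.tex §13 D5(a); this file] -/
theorem abs_gcMean_sub_card_mul_atomicDensity_le (hL : 3 ≤ L) {β : ℝ} (hβ : β ≠ 0)
    (t' U s : ℝ) {c₀ u₀ R a δ r r₁ : ℝ} (hc₀ : 0 ≤ c₀) (hv : |β * U| ≤ u₀) (hR : 0 < R)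
    (hfloor : 1 ≤ R ^ 2 * (1 - (1 - c₀) / 2 - (1 - c₀ ^ 2) / (1 + Real.exp (-(u₀ / 2))) ^ 2))
    (ha : 0 < a) (hδ : 0 < δ)
    (hsmall : 16 * (|β| * (1 + |t'|)) * Real.exp (2 * (|β| * (1 + |t'|))) *
      (R * Real.exp (a + δ) + a) ^ 2 ≤ a)
    (hr : 0 < r) (hrr₁ : r < r₁) (hr₁ : r₁ ≤ Real.pi / 4) (hc₀r : c₀ ≤ Real.cos r₁) :
    |gcMean (ttSectorWeight L β t' U) (Fintype.card (Orb (FermionTorus 2 L))) s -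
        Fintype.card (FermionTorus 2 L) * atomicDensity (β * U) s| ≤
      2 * (a * Fintype.card (FermionTorus 2 L)) / r := by
  have hs : (s : ℂ) ∈ ball (s : ℂ) r₁ := mem_ball_self (hr.trans hrr₁)
  -- geometry of the disc: inside the strip and on the arc
  have hpi4 : ∀ ζ ∈ ball (s : ℂ) r₁, |ζ.im| ≤ Real.pi / 4 :=
    fun ζ hζ => (abs_im_lt_of_mem_ball_ofReal hζ).le.trans hr₁
  have hcos : ∀ ζ ∈ ball (s : ℂ) r₁, c₀ ≤ Real.cos ζ.im := fun ζ hζ => by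
    rw [← Real.cos_abs]
    exact hc₀r.trans (Real.cos_le_cos_of_nonneg_of_le_pi (abs_nonneg _)
      (by linarith [Real.pi_pos]) (abs_im_lt_of_mem_ball_ofReal hζ).le)
  have hz : ∀ ζ ∈ ball (s : ℂ) r₁, atomicPartitionFn (β : ℂ) (U : ℂ) (ζ / β) ≠ 0 :=
    fun ζ hζ => by
    rw [atomicPartitionFn_div_eq_atomicZC β U hβ]
    exact atomicZC_ne_zero _ (hpi4 ζ hζ)
  have hsmallζ : ∀ ζ ∈ ball (s : ℂ) r₁,
      16 * (|β| * (1 + |t'|)) * Real.exp (2 * (|β| * (1 + |t'|))) *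
        (siteRatio (β : ℂ) (U : ℂ) (ζ / β) * Real.exp (a + δ) + a) ^ 2 ≤ a := fun ζ hζ => by
    have hsr : siteRatio (β : ℂ) (U : ℂ) (ζ / β) ≤ R :=
      siteRatio_le_of_arc β U hβ ζ c₀ u₀ R hc₀ (hcos ζ hζ) (abs_le.1 hv).1 hR hfloor
    have hr0 : 0 ≤ siteRatio (β : ℂ) (U : ℂ) (ζ / β) := siteRatio_nonneg _ _ _
    exact le_trans (mul_le_mul_of_nonneg_left (pow_le_pow_left₀ (by positivity)
      (by nlinarith [Real.exp_pos (a + δ)]) 2) (by positivity)) hsmall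
  -- the two logarithms
  obtain ⟨g₁, hg₁_def⟩ : ∃ g : ℂ → ℂ, g = fun ζ : ℂ =>
      (Fintype.card (FermionTorus 2 L) : ℂ) * Complex.log (atomicZC (β * U) ζ) := ⟨_, rfl⟩
  obtain ⟨g₂, hg₂_def⟩ : ∃ g : ℂ → ℂ, g = fun ζ : ℂ =>
      polymerLogZ polyInc (ttActivityMu L β t' U (ζ / β) 0)
        (Finset.univ : Finset (FermionTorus 2 L)).powerset := ⟨_, rfl⟩
  have hg₂ : DifferentiableOn ℂ g₂ (ball (s : ℂ) r₁) := by
    rw [hg₂_def]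
    exact differentiableOn_polymerLogZ_ttActivityMu hL β t' U 0 isOpen_ball hz ha hδ hsmallζ
  have hd₁ : ∀ ζ ∈ ball (s : ℂ) r₁, HasDerivAt g₁ ((Fintype.card (FermionTorus 2 L) : ℂ) *
      (atomicZC₁ (β * U) ζ / atomicZC (β * U) ζ)) ζ := fun ζ hζ => by
    rw [hg₁_def]
    exact ((hasDerivAt_atomicZC (β * U) ζ).clog (atomicZC_mem_slitPlane _ (hpi4 ζ hζ))).const_mul _
  have hg₁ : DifferentiableOn ℂ g₁ (ball (s : ℂ) r₁) :=
    fun ζ hζ => (hd₁ ζ hζ).differentiableAt.differentiableWithinAt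
  -- `g₁'(s) = |Λ| z'(s)/z(s) = |Λ| n_at(s)`, real
  have hD : (deriv g₁ (s : ℂ)).re = Fintype.card (FermionTorus 2 L) * atomicDensity (β * U) s := by
    rw [(hd₁ _ hs).deriv, atomicZC_ofReal, atomicZC₁_ofReal]
    have hcast : (Fintype.card (FermionTorus 2 L) : ℂ) *
        (((2 * Real.exp s + 2 * Real.exp (2 * s - β * U) : ℝ) : ℂ) / ((atomicZ (β * U) s : ℝ) : ℂ))
        = (((Fintype.card (FermionTorus 2 L) : ℝ) *
            ((2 * Real.exp s + 2 * Real.exp (2 * s - β * U)) / atomicZ (β * U) s) : ℝ) : ℂ) := by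
      push_cast; ring
    rw [hcast, Complex.ofReal_re]
    rfl
  -- `e^{g₁ + g₂} = Zc = Σ e^{ζk} w_k` on the disc
  have hexp : ∀ ζ ∈ ball (s : ℂ) r₁, cexp (g₁ ζ + g₂ ζ) =
      gcPowSumC 0 (ttSectorWeight L β t' U) (Fintype.card (Orb (FermionTorus 2 L))) ζ := by
    intro ζ hζ
    have hS := isSmallActivityA_ttActivityMu hL β t' U 0 (hz ζ hζ) ha hδ (hsmallζ ζ hζ)
    simp only [hg₁_def, hg₂_def]
    rw [Complex.exp_add, Complex.exp_nat_mul, Complex.exp_log (atomicZC_ne_zero _ (hpi4 ζ hζ)),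
      hS.exp_polymerLogZ, ← atomicPartitionFn_div_eq_atomicZC β U hβ ζ,
      ← Zc_ttFluxCoupling_eq_mul_polymerPartitionFunction_complexMu hL β t' U 0 (hz ζ hζ),
      Zc_div_eq_gcPowSumC hL hβ t' U ζ]
  -- the oscillation of `g₂` on the circle: twice the free-energy bound
  have hC : ∀ ζ ∈ sphere (s : ℂ) r, ‖g₂ ζ - g₂ s‖ ≤ 2 * (a * Fintype.card (FermionTorus 2 L)) := by
    intro ζ hζ
    have hζ' : ζ ∈ ball (s : ℂ) r₁ :=
      (sphere_subset_closedBall.trans (closedBall_subset_ball hrr₁)) hζ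
    simp only [hg₂_def]
    have h1 := norm_polymerLogZ_ttActivityMu_le hL β t' U 0 (hz ζ hζ') ha hδ (hsmallζ ζ hζ')
    have h2 := norm_polymerLogZ_ttActivityMu_le hL β t' U 0 (hz _ hs) ha hδ (hsmallζ _ hs)
    exact (norm_sub_le _ _).trans (by linarith)
  -- the first-derivative Cauchy estimate
  have h := abs_gcMean_sub_le_of_exp_add_eq _ _ s hr hrr₁ hg₁ hg₂ hexp hC
  rwa [hD] at h

/-- **THE CENTRED FUGACITY IN DENSITY COORDINATES (D5(a)).** Under the hypotheses of
`abs_gcMean_sub_card_mul_atomicDensity_le`, at any `s` with `gcMean w n s = ν` (e.g. the centred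
`s*` of #211.7 `exists_gcMean_eq`, `ν = N`): `|n_at(βU, s) - ν/|Λ_L|| ≤ 2a/r`.
[programme: bounds.tex §13 D5(a); this file] -/
theorem abs_atomicDensity_sub_le_of_gcMean_eq (hL : 3 ≤ L) {β : ℝ} (hβ : β ≠ 0)
    (t' U s : ℝ) {c₀ u₀ R a δ r r₁ : ℝ} (hc₀ : 0 ≤ c₀) (hv : |β * U| ≤ u₀) (hR : 0 < R)
    (hfloor : 1 ≤ R ^ 2 * (1 - (1 - c₀) / 2 - (1 - c₀ ^ 2) / (1 + Real.exp (-(u₀ / 2))) ^ 2))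
    (ha : 0 < a) (hδ : 0 < δ)
    (hsmall : 16 * (|β| * (1 + |t'|)) * Real.exp (2 * (|β| * (1 + |t'|))) *
      (R * Real.exp (a + δ) + a) ^ 2 ≤ a)
    (hr : 0 < r) (hrr₁ : r < r₁) (hr₁ : r₁ ≤ Real.pi / 4) (hc₀r : c₀ ≤ Real.cos r₁) {ν : ℝ}
    (hν : gcMean (ttSectorWeight L β t' U) (Fintype.card (Orb (FermionTorus 2 L))) s = ν) :
    |atomicDensity (β * U) s - ν / Fintype.card (FermionTorus 2 L)| ≤ 2 * a / r := by
  have h := abs_gcMean_sub_card_mul_atomicDensity_le hL hβ t' U s hc₀ hv hR hfloor ha hδ hsmall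
    hr hrr₁ hr₁ hc₀r
  rw [hν] at h
  have hΛ : (0 : ℝ) < Fintype.card (FermionTorus 2 L) := by
    have : 0 < Fintype.card (FermionTorus 2 L) := Fintype.card_pos
    exact_mod_cast this
  have key : atomicDensity (β * U) s - ν / Fintype.card (FermionTorus 2 L) =
      -((ν - Fintype.card (FermionTorus 2 L) * atomicDensity (β * U) s) /
        Fintype.card (FermionTorus 2 L)) := by
    field_simp
    ring
  rw [key, abs_neg, abs_div, abs_of_pos hΛ, div_le_div_iff₀ hΛ hr]
  have h' := (le_div_iff₀ hr).1 h
  nlinarith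

/-- **THE CENTRED FUGACITY WINDOW (D5(a)).** Under the same hypotheses, if `gcMean w n s = ν` and
two test points satisfy `n_at(βU, s₋) + 2a/r ≤ ν/|Λ_L| ≤ n_at(βU, s₊) - 2a/r`, then
`s₋ ≤ s ≤ s₊`: every `s`-dependent constant of Theorem 13_N may be bounded over `[s₋, s₊]`.
[programme: bounds.tex §13 D5(a); this file] -/
theorem ttCentredFugacity_mem_window (hL : 3 ≤ L) {β : ℝ} (hβ : β ≠ 0)
    (t' U s : ℝ) {c₀ u₀ R a δ r r₁ : ℝ} (hc₀ : 0 ≤ c₀) (hv : |β * U| ≤ u₀) (hR : 0 < R)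
    (hfloor : 1 ≤ R ^ 2 * (1 - (1 - c₀) / 2 - (1 - c₀ ^ 2) / (1 + Real.exp (-(u₀ / 2))) ^ 2))
    (ha : 0 < a) (hδ : 0 < δ)
    (hsmall : 16 * (|β| * (1 + |t'|)) * Real.exp (2 * (|β| * (1 + |t'|))) *
      (R * Real.exp (a + δ) + a) ^ 2 ≤ a)
    (hr : 0 < r) (hrr₁ : r < r₁) (hr₁ : r₁ ≤ Real.pi / 4) (hc₀r : c₀ ≤ Real.cos r₁) {ν : ℝ}
    (hν : gcMean (ttSectorWeight L β t' U) (Fintype.card (Orb (FermionTorus 2 L))) s = ν)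
    {sm sp : ℝ} (hm : atomicDensity (β * U) sm + 2 * a / r ≤ ν / Fintype.card (FermionTorus 2 L))
    (hp : ν / Fintype.card (FermionTorus 2 L) ≤ atomicDensity (β * U) sp - 2 * a / r) :
    sm ≤ s ∧ s ≤ sp :=
  mem_window_of_abs_atomicDensity_sub_le
    (abs_atomicDensity_sub_le_of_gcMean_eq hL hβ t' U s hc₀ hv hR hfloor ha hδ hsmall hr hrr₁ hr₁
      hc₀r hν) hm hp

end Torus

end Summit.HubbardSuperconductivity.HubbardLadder.Bounds
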